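import Summits.CriticalPhenomena.PercolationContinuityZ3.Theorems.Transplant.ZdTimesFiniteOfBoxProdZ2
import Summits.CriticalPhenomena.PercolationContinuityZ3.Theorems.Transplant.SlabProdIso
import Summits.CriticalPhenomena.PercolationContinuityZ3.Theorems.Transplant.BSConj4BoxProdZ2OfSkeletonNode
import Summits.CriticalPhenomena.PercolationContinuityZ3.Theorems.Transplant.BoxProdZ2Tubes
import HarnessLib

/-!
# Corollaries of the product flagship: slabs of `ℤ^d` (`d ≥ 4`) and `ℤ^d × F` (`d ≥ 3`) at their own critical points, from `BSConj4_boxProdZ2`,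
# hence from the ONE node `SamePWitnessOfSkeleton` plus tube-subcriticality

builds on p205010 (kernel theorem, internal audit signed; external expert review pending).
Status sentence (coordinator 2026-08-20T04:30Z): "θ(p_c) = 0 on ℤ^d, all d ≥ 2 — kernel-verified (Lean 4/Mathlib,
standard axioms); internal adversarial audit SIGNED 2026-08-20 04:29Z; external expert review pending."

Lane `prim-bschramm-*`, seat `prim-bschramm-stmt`.  PROOF-ONLY chaining of landed reductions between the lane's `@[conjecture]` targets
(`Transplant/StatementLattices.lean`, `Transplant/StatementBoxProdZ2.lean`): p2's `slabOwnCriticalContinuity_of_zdTimesFinite`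
(`SlabProdIso.lean`: `S_k ⊂ ℤ^{n+1}` is `ℤ^n □ P_{k+1}`), the seat's `zdTimesFiniteOwnCriticalContinuity_of_bsConj4_boxProdZ2`
(`ZdTimesFiniteOfBoxProdZ2.lean`: `ℤ^{a+2} □ F ≅ (ℤ^a □ F) □ ℤ²`), and the lead's `bsConj4_boxProdZ2_of_skeletonNode`
(`BSConj4BoxProdZ2OfSkeletonNode.lean`: the general node + tubes ⇒ the product target).  (Box products are spelled `.boxProd`: the `□` notation
is shadowed by a category-theory notation in this import closure.)

* `slabOwnCriticalContinuity_of_bsConj4_boxProdZ2 (d ≥ 4) : BSConj4_boxProdZ2 → SlabOwnCriticalContinuity d` (`d = 3` is the tree's DCST theorem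
  `slabOwnCriticalContinuity_three`, so **`slabOwnCriticalContinuity_of_bsConj4_boxProdZ2' (d ≥ 3)`** covers all slab targets);
* `zdTimesFiniteOwnCriticalContinuity_of_skeletonNode (d ≥ 3)`, `slabOwnCriticalContinuity_of_skeletonNode (d ≥ 3)`: the same targets from
  `SamePWitnessOfSkeleton` and tube-subcriticality at `p_c` for all products (p3's deliverable); primed forms `…_of_skeletonNode'` and
  `…_of_prodNode` use the lead's hypothesis-free `bsConj4_boxProdZ2_of_skeletonNode'` / `_of_prodNode` (`BoxProdZ2Tubes.lean`, p211018).  Nothing open is asserted.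
[cite: BenjaminiSchramm1996, Conj. 4] [cite: DuminilCopinSidoraviciusTassion2016, Thm. 1 and §1 ("Two generalizations")] [cite: MartineauPanagiotis2025, Prop. 1.10]
-/

noncomputable section

namespace Summit.CriticalPhenomena.PercolationContinuityZ3.Theorems.Transplant

open MeasureTheory Literature.Probability.Percolation Literature.Probability.LatticeModels
open Literature.Barriers.CriticalPhenomena (IsQuasiTransitive)

/-- **Slabs of `ℤ^d`, `d ≥ 4`, at their own critical points follow from the product target** (`S_k ⊂ ℤ^d` is `(ℤ^{d-3} □ P_{k+1}) □ ℤ²` with an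
infinite quasi-transitive first factor). [cite: BenjaminiSchramm1996, Conj. 4] [cite: DuminilCopinSidoraviciusTassion2016, §1 ("Two generalizations")] -/
theorem slabOwnCriticalContinuity_of_bsConj4_boxProdZ2 (d : ℕ) [NeZero d] (hd : 4 ≤ d) (h : BSConj4_boxProdZ2) :
    SlabOwnCriticalContinuity d := by
  obtain ⟨n, rfl⟩ : ∃ n, d = n + 1 := ⟨d - 1, by omega⟩
  exact slabOwnCriticalContinuity_of_zdTimesFinite (zdTimesFiniteOwnCriticalContinuity_of_bsConj4_boxProdZ2 n (by omega) h)

/-- **All slab targets `d ≥ 3` from the product target** (`d = 3`: Duminil-Copin–Sidoravicius–Tassion, tree theorem `slabOwnCriticalContinuity_three`,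
unconditionally). [cite: DuminilCopinSidoraviciusTassion2016, Thm. 1] [cite: BenjaminiSchramm1996, Conj. 4] -/
theorem slabOwnCriticalContinuity_of_bsConj4_boxProdZ2' (d : ℕ) [NeZero d] (hd : 3 ≤ d) (h : BSConj4_boxProdZ2) :
    SlabOwnCriticalContinuity d := by
  rcases Nat.lt_or_ge d 4 with hlt | hge
  · obtain rfl : d = 3 := by omega
    exact slabOwnCriticalContinuity_three
  · exact slabOwnCriticalContinuity_of_bsConj4_boxProdZ2 d hge h

/-- **`ℤ^d × F` (`d ≥ 3`) from the general node + tubes**: `SamePWitnessOfSkeleton` and tube-subcriticality at `p_c` for all products give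
`ZdTimesFiniteOwnCriticalContinuity d` (lead's `bsConj4_boxProdZ2_of_skeletonNode`, then R1b ⇐ R2c). [cite: BenjaminiSchramm1996, Conj. 4] [cite: MartineauSevero2019, Cor. 2.2] -/
theorem zdTimesFiniteOwnCriticalContinuity_of_skeletonNode (d : ℕ) (hd : 3 ≤ d)
    (hT : ∀ {W : Type} [DecidableEq W] (X : SimpleGraph W) [X.LocallyFinite], X.Connected → IsQuasiTransitive X → Infinite W →
      ∀ w : W, BoxProdZ2.TubeSubcritical X (criticalProbIOf (X.boxProd (zdGraph 2)) (w, (0 : Site 2))))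
    (hW : SamePWitnessOfSkeleton) : ZdTimesFiniteOwnCriticalContinuity d :=
  zdTimesFiniteOwnCriticalContinuity_of_bsConj4_boxProdZ2 d hd (bsConj4_boxProdZ2_of_skeletonNode hT hW)

/-- **Slabs of `ℤ^d` (`d ≥ 3`) from the general node + tubes.** [cite: BenjaminiSchramm1996, Conj. 4] [cite: MartineauSevero2019, Cor. 2.2] -/
theorem slabOwnCriticalContinuity_of_skeletonNode (d : ℕ) [NeZero d] (hd : 3 ≤ d)
    (hT : ∀ {W : Type} [DecidableEq W] (X : SimpleGraph W) [X.LocallyFinite], X.Connected → IsQuasiTransitive X → Infinite W →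
      ∀ w : W, BoxProdZ2.TubeSubcritical X (criticalProbIOf (X.boxProd (zdGraph 2)) (w, (0 : Site 2))))
    (hW : SamePWitnessOfSkeleton) : SlabOwnCriticalContinuity d :=
  slabOwnCriticalContinuity_of_bsConj4_boxProdZ2' d hd (bsConj4_boxProdZ2_of_skeletonNode hT hW)

/-! ## Hypothesis-free forms (the tubes are the lead's `BoxProdZ2Tube.tubeSubcritical_criticalProb`, p211018) -/

/-- **`ℤ^d × F` (`d ≥ 3`) at its own critical point from the ONE node alone**: `SamePWitnessOfSkeleton → ZdTimesFiniteOwnCriticalContinuity d`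
(tube-subcriticality at `p_c` is now a tree theorem for every connected quasi-transitive `X`, `bsConj4_boxProdZ2_of_skeletonNode'`).
[cite: BenjaminiSchramm1996, Conj. 4] [cite: MartineauSevero2019, Cor. 2.2] -/
theorem zdTimesFiniteOwnCriticalContinuity_of_skeletonNode' (d : ℕ) (hd : 3 ≤ d) (hW : SamePWitnessOfSkeleton) :
    ZdTimesFiniteOwnCriticalContinuity d :=
  zdTimesFiniteOwnCriticalContinuity_of_bsConj4_boxProdZ2 d hd (bsConj4_boxProdZ2_of_skeletonNode' hW)

/-- **Slabs of `ℤ^d` (`d ≥ 3`) at their own critical points from the ONE node alone.** [cite: BenjaminiSchramm1996, Conj. 4] [cite: MartineauSevero2019, Cor. 2.2] -/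
theorem slabOwnCriticalContinuity_of_skeletonNode' (d : ℕ) [NeZero d] (hd : 3 ≤ d) (hW : SamePWitnessOfSkeleton) :
    SlabOwnCriticalContinuity d :=
  slabOwnCriticalContinuity_of_bsConj4_boxProdZ2' d hd (bsConj4_boxProdZ2_of_skeletonNode' hW)

/-- The product node `SamePWitnessBoxProdZ2` also suffices (lead's `bsConj4_boxProdZ2_of_prodNode`). [cite: BenjaminiSchramm1996, Conj. 4] -/
theorem zdTimesFiniteOwnCriticalContinuity_of_prodNode (d : ℕ) (hd : 3 ≤ d) (hW : SamePWitnessBoxProdZ2) :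
    ZdTimesFiniteOwnCriticalContinuity d :=
  zdTimesFiniteOwnCriticalContinuity_of_bsConj4_boxProdZ2 d hd (bsConj4_boxProdZ2_of_prodNode hW)

end Summit.CriticalPhenomena.PercolationContinuityZ3.Theorems.Transplant
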